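import Summits.BirchSwinnertonDyer.BirchSwinnertonDyer.Theorems.TwistFamilyManinDescentTwistFamilyDescent
import Summits.BirchSwinnertonDyer.BirchSwinnertonDyer.Theorems.TwistFamilyManinDescentIsogenyTableFamiliesCrude
import Summits.BirchSwinnertonDyer.BirchSwinnertonDyer.Theorems.TwistFamilyManinDescentIsogenyTableFamiliesDyadic
import Summits.BirchSwinnertonDyer.BirchSwinnertonDyer.Theorems.TwistFamilyManinDescentIsogenyTableFamilyOddTwists
import HarnessLib

/-!
# Route `TwistFamilyManinDescent` — crux `IsogenyTableFamiliesManinOne` (stmt-BirchSwinnertonDyer-25137, rank 3)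
# closed by name: the eleven Mazur–Kenku isogeny-table `j`-families have the class Manin certificate

HONEST FRAMING. The item is CONDITIONAL on its two leading binders — modularity (`exists_isNewformOf`) and
Cremona's verified range (`cremona_abs_maninConstant_eq_one_of_level_le_500000`, |c| = 1 for `N ≤ 5·10⁵`) — both
cite-only PRINTED facts. Granted them, it asserts the class Manin certificate (|c| = 1 at every lattice-optimal
`X₀`-datum of every globally minimal member of the class) for EVERY elliptic `W/ℚ` whose `j`-invariant is one of
the eleven values of the rational-isogeny table for `ℓ ∈ {11, 17, 19, 37, 43, 67, 163}` (for `j(−163)` under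
`2⁶ ∤ N(W)`): infinitely many isogeny classes of unbounded conductor. The proof is the assembly of the eleven family
theorems (`…IsogenyTableFamiliesCrude`, `…Dyadic`, `…OddTwists`) — each a base curve + whole-family descent
(`twistFamilyDescent_proof`, item 25136) + Cremona on the finitely many inner twists through crude / dyadic conductor
bounds. Manin's conjecture itself is NOT proved (the residual 25138 and all non-table classes are untouched); BSD is
not proved by this.
-/

-- D-0017: single-problem summit, so `Summit.BirchSwinnertonDyer.BirchSwinnertonDyer.…` repeats a namespace BY DESIGN.
set_option linter.dupNamespace false
set_option autoImplicit false

noncomputable section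

open scoped Classical

open WeierstrassCurve Literature.NumberTheory.EllipticCurves Literature.NumberTheory.EllipticCurves.ModularForms
  Summit.BirchSwinnertonDyer.BirchSwinnertonDyer.Theses.TwistFamilyManinDescent

namespace Summit.BirchSwinnertonDyer.BirchSwinnertonDyer.Theorems.TwistFamilyManinDescent

/-- **Item stmt-BirchSwinnertonDyer-25137 by name** (`IsogenyTableFamiliesManinOne`): granted modularity and Cremona's
range, every elliptic `W/ℚ` with `j(W)` in the isogeny table (the `j(−163)` row under `2⁶ ∤ N(W)`) satisfies
`ClassAbsManinConstantEqOne W`. Case analysis on the eleven `j`-values over the family theorems.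
[cite: Mazur1978, Thm. 1] [cite: Kenku1982, Thm. 1] [cite: CremonaAlgorithms1997, §3.8 and Table 1]
[cite: Stevens1989, Lemmas (5.2), (5.4)] [cite: BarriosEtAl2025, Thm. 5.1] -/
theorem isogenyTableFamiliesManinOne_proof : IsogenyTableFamiliesManinOne := by
  unfold IsogenyTableFamiliesManinOne
  intro hnf hCre W _ hj
  have hT := twistFamilyDescent_proof hnf
  rcases hj with hmem | ⟨hj163, hN⟩
  · simp only [Finset.mem_insert, Finset.mem_singleton] at hmem
    rcases hmem with h | h | h | h | h | h | h | h | h | h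
    · exact classAbsManinConstantEqOne_of_j_eq_neg_32768 hT hnf hCre W h
    · exact classAbsManinConstantEqOne_of_j_eq_neg_121 hT hnf hCre W h
    · exact classAbsManinConstantEqOne_of_j_eq_neg_24729001 hT hnf hCre W h
    · exact classAbsManinConstantEqOne_of_j_eq_neg_297756989_div_2 hT hnf hCre W h
    · exact classAbsManinConstantEqOne_of_j_eq_neg_882216989_div_131072 hT hnf hCre W h
    · exact classAbsManinConstantEqOne_of_j_eq_neg_884736 hT hnf hCre W h
    · exact classAbsManinConstantEqOne_of_j_eq_neg_9317 hT hnf hCre W h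
    · exact classAbsManinConstantEqOne_of_j_eq_neg_162677523113838677 hT hnf hCre W h
    · exact classAbsManinConstantEqOne_of_j_eq_neg_884736000 hT hnf hCre W h
    · exact classAbsManinConstantEqOne_of_j_eq_neg_147197952000 hT hnf hCre W h
  · exact classAbsManinConstantEqOne_of_j_eq_neg_640320_cube hnf hCre hT W hj163 hN

end Summit.BirchSwinnertonDyer.BirchSwinnertonDyer.Theorems.TwistFamilyManinDescent

end
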